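import Mathlib
import Summits.Ventures.PercRepro2.CoinOrTailAlg
import Summits.Ventures.PercRepro2.CoinOrTailMixLsm
import Summits.Ventures.PercRepro2.CoinOrTailKDefs
import Summits.Ventures.PercRepro2.CoinOrTailKSums

/-!
# The k-entry tail-mixed values are log-supermodular — unconditionally (blind cell PercRepro2,
night-2 g10; proofs/NIGHT2-DARC.md §41)

The extended lattice of §40.1 for `k` entries is `Finset V × Finset V`: a cluster `W` together
with the set `P ⊆ ent` of its OPEN EFFECTIVE entry coins, weighted by
`extWtK W P = Π_{r ∈ ent} effWt (p(c r)) (r ∈ W) [r ∈ P]` and valued by the head at `W ∪ X` if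
`P ≠ ∅`, at `W` otherwise (`extValK`).  The weight is log-supermodular (a product of the
sixteen-case lemma `effWt_mul_le`), the value is (`headPart_le` with the bit `P ≠ ∅`), and the
fibre sum over `P ⊆ ent` is the tail-mixed value `tailWtK W · A W + (1 − tailWtK W) · A (W ∪ X)`
(`sum_extValK`; the weights sum to `1` by `Finset.prod_add`).  Ahlswede–Daykin
(`four_functions_theorem_univ`) on the product lattice gives `mixValK_mul_le_all`, hence
`rValK_mul_le_all`, `gValK_mul_le_all`, `gValK_mul_le_rValK_gValK_all`.
-/

namespace Summit.Ventures.PercRepro2.Coin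

open Classical

section ExtK

variable {V : Type*} {E : Type*} [DecidableEq V] {R : Type*} [Field R] [LinearOrder R]
  [IsStrictOrderedRing R]

/-- The extended weight of `(W, P)`: the effective coins of the entries, open exactly on `P`. -/
def extWtK (pr : E → R) (ent : Finset V) (c : V → E) (W P : Finset V) : R :=
  ∏ r ∈ ent, effWt (pr (c r)) (r ∈ W) (decide (r ∈ P))

/-- The bit «some effective coin is open». -/
def openBit (P : Finset V) : Bool := !decide (P = ∅)

/-- The extended value of `(W, P)`. -/
def extValK (A : Finset V → R) (pr : E → R) (ent : Finset V) (c : V → E) (X : Finset V)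
    (x : Finset V × Finset V) : R :=
  extWtK pr ent c x.1 x.2 * A (x.1 ∪ tailAdd' X (openBit x.2))

omit [Field R] [LinearOrder R] [IsStrictOrderedRing R] in
/-- Membership in an intersection, as Booleans. -/
lemma decide_mem_inter' (r : V) (P Q : Finset V) :
    decide (r ∈ P ∩ Q) = (decide (r ∈ P) && decide (r ∈ Q)) := by
  by_cases h1 : r ∈ P <;> by_cases h2 : r ∈ Q <;> simp [h1, h2]

omit [Field R] [LinearOrder R] [IsStrictOrderedRing R] in
/-- Membership in a union, as Booleans. -/
lemma decide_mem_union' (r : V) (P Q : Finset V) :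
    decide (r ∈ P ∪ Q) = (decide (r ∈ P) || decide (r ∈ Q)) := by
  by_cases h1 : r ∈ P <;> by_cases h2 : r ∈ Q <;> simp [h1, h2]

omit [Field R] [LinearOrder R] [IsStrictOrderedRing R] in
/-- The open bit of a union. -/
lemma openBit_union (P Q : Finset V) : openBit (P ∪ Q) = (openBit P || openBit Q) := by
  unfold openBit
  by_cases h1 : P = ∅ <;> by_cases h2 : Q = ∅ <;> simp [h1, h2, Finset.union_eq_empty]

omit [Field R] [LinearOrder R] [IsStrictOrderedRing R] in
/-- The open bit of an intersection forces both. -/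
lemma openBit_inter (P Q : Finset V) :
    openBit (P ∩ Q) = true → openBit P = true ∧ openBit Q = true := by
  unfold openBit
  intro h
  have hne : P ∩ Q ≠ ∅ := by simpa using h
  constructor
  · simpa using fun hP => hne (by rw [hP, Finset.empty_inter])
  · simpa using fun hQ => hne (by rw [hQ, Finset.inter_empty])

/-- `0 ≤ extWtK`. -/
lemma extWtK_nonneg {pr : E → R} (hp0 : ∀ e, 0 ≤ pr e) (hp1 : ∀ e, pr e ≤ 1) (ent : Finset V)
    (c : V → E) (W P : Finset V) : 0 ≤ extWtK pr ent c W P :=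
  Finset.prod_nonneg fun r _ => effWt_nonneg (hp0 (c r)) (hp1 (c r)) _ _

/-- **The extended weights are log-supermodular on `Finset V × Finset V`.** -/
lemma extWtK_mul_le {pr : E → R} (hp0 : ∀ e, 0 ≤ pr e) (hp1 : ∀ e, pr e ≤ 1) (ent : Finset V)
    (c : V → E) (W W' P Q : Finset V) :
    extWtK pr ent c W P * extWtK pr ent c W' Q ≤
      extWtK pr ent c (W ∩ W') (P ∩ Q) * extWtK pr ent c (W ∪ W') (P ∪ Q) := by
  unfold extWtK
  rw [← Finset.prod_mul_distrib, ← Finset.prod_mul_distrib]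
  apply Finset.prod_le_prod
  · intro r _
    exact mul_nonneg (effWt_nonneg (hp0 (c r)) (hp1 (c r)) _ _)
      (effWt_nonneg (hp0 (c r)) (hp1 (c r)) _ _)
  · intro r _
    have h := effWt_mul_le (hp0 (c r)) (r ∈ W) (r ∈ W') (decide (r ∈ P)) (decide (r ∈ Q))
    have e1 : effWt (pr (c r)) (r ∈ W ∩ W') (decide (r ∈ P ∩ Q)) =
        effWt (pr (c r)) (r ∈ W ∧ r ∈ W') (decide (r ∈ P) && decide (r ∈ Q)) := by
      rw [decide_mem_inter']; simp only [effWt, Finset.mem_inter]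
    have e2 : effWt (pr (c r)) (r ∈ W ∪ W') (decide (r ∈ P ∪ Q)) =
        effWt (pr (c r)) (r ∈ W ∨ r ∈ W') (decide (r ∈ P) || decide (r ∈ Q)) := by
      rw [decide_mem_union']; simp only [effWt, Finset.mem_union]
    rw [e1, e2]
    exact h

/-- `0 ≤ extValK`. -/
lemma extValK_nonneg {A : Finset V → R} {pr : E → R} (hp0 : ∀ e, 0 ≤ pr e)
    (hp1 : ∀ e, pr e ≤ 1) (hA0 : ∀ W, 0 ≤ A W) (ent : Finset V) (c : V → E) (X : Finset V)
    (x : Finset V × Finset V) : 0 ≤ extValK A pr ent c X x :=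
  mul_nonneg (extWtK_nonneg hp0 hp1 ent c _ _) (hA0 _)

/-- **The extended values are log-supermodular on the extended lattice** (mixed form,
`X' ⊆ X` in the meet slot). -/
lemma extValK_mul_le {A : Finset V → R} {pr : E → R} (hp0 : ∀ e, 0 ≤ pr e) (hp1 : ∀ e, pr e ≤ 1)
    (hA0 : ∀ W, 0 ≤ A W) (hA : ∀ s t : Finset V, A s * A t ≤ A (s ∩ t) * A (s ∪ t))
    (hmono : ∀ s t : Finset V, s ⊆ t → A t ≤ A s) (ent : Finset V) (c : V → E)
    {X X' : Finset V} (hX' : X' ⊆ X) (x y : Finset V × Finset V) :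
    extValK A pr ent c X x * extValK A pr ent c X y ≤
      extValK A pr ent c X' (x ⊓ y) * extValK A pr ent c X (x ⊔ y) := by
  obtain ⟨W, P⟩ := x
  obtain ⟨W', Q⟩ := y
  have hinf : ((W, P) : Finset V × Finset V) ⊓ (W', Q) = (W ∩ W', P ∩ Q) := rfl
  have hsup : ((W, P) : Finset V × Finset V) ⊔ (W', Q) = (W ∪ W', P ∪ Q) := rfl
  rw [hinf, hsup]
  simp only [extValK]
  have hw := extWtK_mul_le hp0 hp1 ent c W W' P Q
  have hhead := headPart_le hA0 hA hmono hX' W W' (openBit P) (openBit Q) (openBit (P ∩ Q))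
    (openBit (P ∪ Q)) (openBit_union P Q) (openBit_inter P Q)
  calc extWtK pr ent c W P * A (W ∪ tailAdd' X (openBit P)) *
        (extWtK pr ent c W' Q * A (W' ∪ tailAdd' X (openBit Q)))
      = (extWtK pr ent c W P * extWtK pr ent c W' Q) *
          (A (W ∪ tailAdd' X (openBit P)) * A (W' ∪ tailAdd' X (openBit Q))) := by ring
    _ ≤ (extWtK pr ent c (W ∩ W') (P ∩ Q) * extWtK pr ent c (W ∪ W') (P ∪ Q)) *
          (A (W ∩ W' ∪ tailAdd' X' (openBit (P ∩ Q))) *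
            A (W ∪ W' ∪ tailAdd' X (openBit (P ∪ Q)))) := by
        apply mul_le_mul hw hhead (mul_nonneg (hA0 _) (hA0 _))
        exact mul_nonneg (extWtK_nonneg hp0 hp1 ent c _ _) (extWtK_nonneg hp0 hp1 ent c _ _)
    _ = extWtK pr ent c (W ∩ W') (P ∩ Q) * A (W ∩ W' ∪ tailAdd' X' (openBit (P ∩ Q))) *
          (extWtK pr ent c (W ∪ W') (P ∪ Q) * A (W ∪ W' ∪ tailAdd' X (openBit (P ∪ Q)))) := by
        ring

omit [LinearOrder R] [IsStrictOrderedRing R] in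
/-- The weight of `P = ∅` is the tail weight. -/
lemma extWtK_empty (pr : E → R) (ent : Finset V) (c : V → E) (W : Finset V) :
    extWtK pr ent c W ∅ = tailWtK pr ent c W := by
  unfold extWtK tailWtK
  refine Finset.prod_congr rfl fun r _ => ?_
  simp [effWt]

omit [LinearOrder R] [IsStrictOrderedRing R] in
/-- The extended weights of a cluster sum to `1` over `P ⊆ ent`. -/
lemma sum_extWtK (pr : E → R) (ent : Finset V) (c : V → E) (W : Finset V) :
    ∑ P ∈ ent.powerset, extWtK pr ent c W P = 1 := by
  have key := Finset.prod_add (fun r => effWt (pr (c r)) (r ∈ W) true)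
    (fun r => effWt (pr (c r)) (r ∈ W) false) ent
  have hone : ∏ r ∈ ent, (effWt (pr (c r)) (r ∈ W) true + effWt (pr (c r)) (r ∈ W) false) = 1 := by
    refine Finset.prod_eq_one fun r _ => ?_
    rw [add_comm]; exact effWt_sum _ _
  rw [hone] at key
  rw [key]
  refine Finset.sum_congr rfl fun P hP => ?_
  have hPe : P ⊆ ent := Finset.mem_powerset.1 hP
  unfold extWtK
  rw [← Finset.prod_sdiff hPe, mul_comm]
  congr 1
  · refine Finset.prod_congr rfl fun r hr => ?_
    simp [hr]
  · refine Finset.prod_congr rfl fun r hr => ?_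
    have : r ∉ P := (Finset.mem_sdiff.1 hr).2
    simp [this]

omit [LinearOrder R] [IsStrictOrderedRing R] in
/-- **The fibre sum**: summing the extended value over `P ⊆ ent` gives the tail-mixed value. -/
lemma sum_extValK (A : Finset V → R) (pr : E → R) (ent : Finset V) (c : V → E) (X : Finset V)
    (W : Finset V) :
    ∑ P ∈ ent.powerset, extValK A pr ent c X (W, P) =
      tailWtK pr ent c W * A W + (1 - tailWtK pr ent c W) * A (W ∪ X) := by
  have hmem : (∅ : Finset V) ∈ ent.powerset := Finset.empty_mem_powerset ent
  rw [← Finset.add_sum_erase _ _ hmem]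
  have h0 : extValK A pr ent c X (W, ∅) = tailWtK pr ent c W * A W := by
    simp only [extValK, openBit, decide_true, Bool.not_true, tailAdd', Finset.union_empty]
    rw [extWtK_empty]
  have hrest : ∑ P ∈ ent.powerset.erase ∅, extValK A pr ent c X (W, P) =
      (1 - tailWtK pr ent c W) * A (W ∪ X) := by
    have : ∀ P ∈ ent.powerset.erase ∅, extValK A pr ent c X (W, P) =
        extWtK pr ent c W P * A (W ∪ X) := by
      intro P hP
      have hne : P ≠ ∅ := (Finset.mem_erase.1 hP).1
      simp only [extValK, openBit, hne, decide_false, Bool.not_false, tailAdd']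
    rw [Finset.sum_congr rfl this, ← Finset.sum_mul]
    congr 1
    have hs := sum_extWtK pr ent c W
    rw [← Finset.add_sum_erase _ _ hmem, extWtK_empty] at hs
    linear_combination hs
  rw [h0, hrest]

end ExtK

section MixK

variable {V : Type*} {E : Type*} [Fintype V] [DecidableEq V] {R : Type*} [Field R]
  [LinearOrder R] [IsStrictOrderedRing R]

/-- **THE k-ENTRY TAIL-MIXED VALUES ARE LOG-SUPERMODULAR, UNCONDITIONALLY** (mixed form). -/
theorem mixValK_mul_le_all (A : Finset V → R) (pr : E → R) (ent : Finset V) (c : V → E)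
    {X X' : Finset V} (hX' : X' ⊆ X) (hp0 : ∀ e, 0 ≤ pr e) (hp1 : ∀ e, pr e ≤ 1)
    (hA0 : ∀ W, 0 ≤ A W) (hA : ∀ s t : Finset V, A s * A t ≤ A (s ∩ t) * A (s ∪ t))
    (hmono : ∀ s t : Finset V, s ⊆ t → A t ≤ A s) (s t : Finset V) :
    (tailWtK pr ent c s * A s + (1 - tailWtK pr ent c s) * A (s ∪ X)) *
      (tailWtK pr ent c t * A t + (1 - tailWtK pr ent c t) * A (t ∪ X)) ≤
    (tailWtK pr ent c (s ∩ t) * A (s ∩ t) + (1 - tailWtK pr ent c (s ∩ t)) * A (s ∩ t ∪ X')) *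
      (tailWtK pr ent c (s ∪ t) * A (s ∪ t) + (1 - tailWtK pr ent c (s ∪ t)) * A (s ∪ t ∪ X)) := by
  let f₁ : Finset V × Finset V → R :=
    fun x => if x.1 = s ∧ x.2 ∈ ent.powerset then extValK A pr ent c X x else 0
  let f₂ : Finset V × Finset V → R :=
    fun x => if x.1 = t ∧ x.2 ∈ ent.powerset then extValK A pr ent c X x else 0
  let f₃ : Finset V × Finset V → R :=
    fun x => if x.1 = s ∩ t ∧ x.2 ∈ ent.powerset then extValK A pr ent c X' x else 0
  let f₄ : Finset V × Finset V → R :=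
    fun x => if x.1 = s ∪ t ∧ x.2 ∈ ent.powerset then extValK A pr ent c X x else 0
  have h₁ : 0 ≤ f₁ := fun x => by
    simp only [f₁]; split_ifs
    · exact extValK_nonneg hp0 hp1 hA0 _ _ _ _
    · exact le_rfl
  have h₂ : 0 ≤ f₂ := fun x => by
    simp only [f₂]; split_ifs
    · exact extValK_nonneg hp0 hp1 hA0 _ _ _ _
    · exact le_rfl
  have h₃ : 0 ≤ f₃ := fun x => by
    simp only [f₃]; split_ifs
    · exact extValK_nonneg hp0 hp1 hA0 _ _ _ _
    · exact le_rfl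
  have h₄ : 0 ≤ f₄ := fun x => by
    simp only [f₄]; split_ifs
    · exact extValK_nonneg hp0 hp1 hA0 _ _ _ _
    · exact le_rfl
  have h : ∀ x y, f₁ x * f₂ y ≤ f₃ (x ⊓ y) * f₄ (x ⊔ y) := by
    intro x y
    simp only [f₁, f₂, f₃, f₄]
    by_cases hx : x.1 = s ∧ x.2 ∈ ent.powerset
    · by_cases hy : y.1 = t ∧ y.2 ∈ ent.powerset
      · have hxy1 : (x ⊓ y).1 = s ∩ t ∧ (x ⊓ y).2 ∈ ent.powerset := by
          refine ⟨by rw [Prod.inf_def]; simp [hx.1, hy.1], ?_⟩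
          rw [Prod.inf_def]
          exact Finset.mem_powerset.2
            ((Finset.inter_subset_left).trans (Finset.mem_powerset.1 hx.2))
        have hxy2 : (x ⊔ y).1 = s ∪ t ∧ (x ⊔ y).2 ∈ ent.powerset := by
          refine ⟨by rw [Prod.sup_def]; simp [hx.1, hy.1], ?_⟩
          rw [Prod.sup_def]
          exact Finset.mem_powerset.2
            (Finset.union_subset (Finset.mem_powerset.1 hx.2) (Finset.mem_powerset.1 hy.2))
        rw [if_pos hx, if_pos hy, if_pos hxy1, if_pos hxy2]
        exact extValK_mul_le hp0 hp1 hA0 hA hmono ent c hX' x y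
      · rw [if_neg hy, mul_zero]
        exact mul_nonneg (h₃ _) (h₄ _)
    · rw [if_neg hx, zero_mul]
      exact mul_nonneg (h₃ _) (h₄ _)
  have key := four_functions_theorem_univ f₁ f₂ f₃ f₄ h₁ h₂ h₃ h₄ h
  have hsum : ∀ (Y W : Finset V),
      (∑ x : Finset V × Finset V,
        if x.1 = W ∧ x.2 ∈ ent.powerset then extValK A pr ent c Y x else 0) =
        tailWtK pr ent c W * A W + (1 - tailWtK pr ent c W) * A (W ∪ Y) := by
    intro Y W
    rw [← sum_extValK A pr ent c Y W, Fintype.sum_prod_type, Finset.sum_comm]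
    simp only [ite_and]
    simp only [Finset.sum_ite_eq', Finset.mem_univ, if_true]
    rw [← Finset.sum_filter]
    congr 1
    ext P
    simp only [Finset.mem_filter, Finset.mem_univ, true_and]
  simp only [f₁, f₂, f₃, f₄] at key
  rwa [hsum, hsum, hsum, hsum] at key

/-- `rValK` is log-supermodular on ALL pairs. -/
theorem rValK_mul_le_all (A : Finset V → R) (pr : E → R) (ent : Finset V) (c : V → E) (a : V)
    (hp0 : ∀ e, 0 ≤ pr e) (hp1 : ∀ e, pr e ≤ 1) (hA0 : ∀ W, 0 ≤ A W)
    (hA : ∀ s t : Finset V, A s * A t ≤ A (s ∩ t) * A (s ∪ t))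
    (hmono : ∀ s t : Finset V, s ⊆ t → A t ≤ A s) (s t : Finset V) :
    rValK A pr ent c a s * rValK A pr ent c a t ≤
      rValK A pr ent c a (s ∩ t) * rValK A pr ent c a (s ∪ t) :=
  mixValK_mul_le_all A pr ent c (Finset.Subset.refl {a}) hp0 hp1 hA0 hA hmono s t

/-- `gValK` is log-supermodular on ALL pairs. -/
theorem gValK_mul_le_all (A : Finset V → R) (pr : E → R) (ent : Finset V) (c : V → E) (a w : V)
    (hp0 : ∀ e, 0 ≤ pr e) (hp1 : ∀ e, pr e ≤ 1) (hA0 : ∀ W, 0 ≤ A W)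
    (hA : ∀ s t : Finset V, A s * A t ≤ A (s ∩ t) * A (s ∪ t))
    (hmono : ∀ s t : Finset V, s ⊆ t → A t ≤ A s) (s t : Finset V) :
    gValK A pr ent c a w s * gValK A pr ent c a w t ≤
      gValK A pr ent c a w (s ∩ t) * gValK A pr ent c a w (s ∪ t) :=
  mixValK_mul_le_all A pr ent c (Finset.Subset.refl {a, w}) hp0 hp1 hA0 hA hmono s t

/-- The mixed step on ALL pairs: `gValK s · gValK t ≤ rValK (s ∩ t) · gValK (s ∪ t)`. -/
theorem gValK_mul_le_rValK_gValK_all (A : Finset V → R) (pr : E → R) (ent : Finset V) (c : V → E)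
    (a w : V) (hp0 : ∀ e, 0 ≤ pr e) (hp1 : ∀ e, pr e ≤ 1) (hA0 : ∀ W, 0 ≤ A W)
    (hA : ∀ s t : Finset V, A s * A t ≤ A (s ∩ t) * A (s ∪ t))
    (hmono : ∀ s t : Finset V, s ⊆ t → A t ≤ A s) (s t : Finset V) :
    gValK A pr ent c a w s * gValK A pr ent c a w t ≤
      rValK A pr ent c a (s ∩ t) * gValK A pr ent c a w (s ∪ t) :=
  mixValK_mul_le_all A pr ent c
    (Finset.singleton_subset_iff.2 (Finset.mem_insert_self a {w})) hp0 hp1 hA0 hA hmono s t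

end MixK

end Summit.Ventures.PercRepro2.Coin
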